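import Summits.ResolutionOfSingularities.ResolutionOfSingularities.Theorems.PurelyInseparableDim4JointHereditaryNodeStep
import Summits.ResolutionOfSingularities.ResolutionOfSingularities.Theorems.PurelyInseparableDim4JointWaitingNodes
import HarnessLib

/-!
# Purely inseparable four-folds: the NODE THEOREM of the joint forest with HEREDITARY waiting members (brick S3 (c) «joint
# point∘coordinate chains», part 65 = v3-H, node theorem; cell `res-dim4-pi`)

[OURS · counted 0] (D-0157 DOOR 2; desk WORD #66 (4)(c), #74 (g), #99 (d); frame `PIDim4.TerminationImpliesOrderReduction`, S3 (c)
v3-H; host item stmt-ResolutionOfSingularities-16155, helper). Nothing here proves resolution of singularities in dimension ≥ 4 /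
characteristic `p` — NOT here, not anywhere in this programme.

Part 54 (`exists_isMarkedResolution_of_joint_forest_waiting`, the threading node theorem) in the v3-H format of part 60: a node
`(X′, M′)` over `(X₀, M₀)` carries point members with `PointData` and pairwise disjoint coordinate members EACH with `MemberDataH` —
own waiting entries `wplan (cst c) (ctr c)` with regions, `BlockH` at every pair below (children WITH hereditary waiting entries,
four-way covers), the model-free boundary invariants — members missing the others' regions, regions of different members disjoint,
points off members and regions, and every closed order-`p` point a point member, on a member, or in a region. Blow up any coordinate
member (part 64) and recurse; with no coordinate member left part 13's point forest finishes. TERMINATION: `CutExpand` of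
`HEdge` (child ∪ waiting-kid edges) on the multiset of the members' pairs. This LIFTS the designed limit of the chain 49–55 (there
children were born with empty waiting sets): the children of a blown-up member host the waiting siblings inside the new exceptional
divisor that `wplan` lists at their pairs.

* `exists_isMarkedResolution_of_joint_forest_hereditary` — the node theorem;
* `exists_isMarkedResolution_of_hereditary_node` — the corollary at `σ = 𝟙`.

AI-produced formalisation, weaker than expert review. bears_on: LADDER-RESOLUTION:D157-DOOR2 (res-dim4-pi · S3 (c) joint v3-H · node theorem).
-/

set_option linter.dupNamespace false -- D-0017: single-problem summit path `Summit.<S>.<S>.…` by design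

noncomputable section

open MvPolynomial Finset CategoryTheory AlgebraicGeometry Opposite TopologicalSpace
open AlgebraicGeometry.Scheme.IdealSheafData (ofIdealTop vanishingIdeal)

namespace Summit.ResolutionOfSingularities.ResolutionOfSingularities.Theorems.PIDim4

open Literature.AlgebraicGeometry.Resolution
open Literature.AlgebraicGeometry.Resolution.Hauser2010
open Literature.AlgebraicGeometry.Resolution.AffinePointBlowup (P A γ coord Wtop ξ)

namespace Equimultiple

section NodesH

variable {K : Type} [Field K] {p : ℕ} [hp : Fact p.Prime] [CharP K p]

/-- **THE NODE THEOREM WITH HEREDITARY WAITING.** See the module docstring. [cite: BierstoneGrigorievMilmanWlodarczyk2011, Def. 3.1.3; §4 Step 2b]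
[cite: Hauser2010, §§F–G] [cite: StacksProject, Tag 02OS] -/
theorem exists_isMarkedResolution_of_joint_forest_hereditary {X₀ : Scheme.{0}} [IsLocallyNoetherian X₀] [JacobsonSpace X₀]
    [IsAlgClosed K] [DecidableEq K] (M₀ : MarkedIdeal X₀) (hE : HasSNC M₀.boundary) (hmult : M₀.mult = p)
    (plan : State K → Finset (Fin 4) → Finset (Fin 4 × (Fin 4 → K) × Finset (Fin 4)))
    (leaves : State K → Finset (Fin 4) → Finset (Fin 4 × (Fin 4 → K)))
    (wplan : State K → Finset (Fin 4) → Finset (Fin 4 × (Fin 4 → K) × Finset (Fin 4)))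
    (T : Multiset (State K × Finset (Fin 4)))
    (hT : Acc (Relation.CutExpand (fun q' q : State K × Finset (Fin 4) => HEdge p plan wplan q' q ∧ q' ≠ q)) T) :
    ∀ (X' : Scheme.{0}) (σ : X' ⟶ X₀) (M' : MarkedIdeal X') (_ : IsMultipleBlowup M₀ σ M')
      (pts : Finset X') (st : X' → State K) (_ : ∀ x ∈ pts, IsClosed ({x} : Set X'))
      (_ : ∀ x ∈ pts, PointData p M' x (st x))
      (cms : Finset (Closeds X')) (cst : Closeds X' → State K) (ctr : Closeds X' → Finset (Fin 4))
      (wreg : Closeds X' → Fin 4 × (Fin 4 → K) × Finset (Fin 4) → Closeds X')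
      (_ : ∑ c ∈ cms, ({(cst c, ctr c)} : Multiset (State K × Finset (Fin 4))) = T)
      (_ : ∀ c ∈ cms, MemberDataH p plan leaves wplan M' c (cst c) (ctr c) (wreg c))
      (_ : ∀ c ∈ cms, ∀ c' ∈ cms, c ≠ c' → Disjoint (c : Set X') (c' : Set X'))
      (_ : ∀ c ∈ cms, ∀ c' ∈ cms, c ≠ c' → ∀ wt ∈ wplan (cst c') (ctr c'), Disjoint (c : Set X') (wreg c' wt : Set X'))
      (_ : ∀ c ∈ cms, ∀ c' ∈ cms, c ≠ c' → ∀ wt ∈ wplan (cst c) (ctr c), ∀ wt' ∈ wplan (cst c') (ctr c'),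
        Disjoint (wreg c wt : Set X') (wreg c' wt' : Set X'))
      (_ : ∀ x ∈ pts, ∀ c ∈ cms, x ∉ (c : Set X'))
      (_ : ∀ x ∈ pts, ∀ c ∈ cms, ∀ wt ∈ wplan (cst c) (ctr c), x ∉ (wreg c wt : Set X'))
      (_ : ∀ z : X', IsClosed ({z} : Set X') → (p : ℕ∞) ≤ idealOrder M'.ideal z →
        z ∈ pts ∨ (∃ c ∈ cms, z ∈ (c : Set X')) ∨ ∃ c ∈ cms, ∃ wt ∈ wplan (cst c) (ctr c), z ∈ (wreg c wt : Set X')),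
      ∃ (X'' : Scheme.{0}) (ρ : X'' ⟶ X₀) (M'' : MarkedIdeal X''), IsMarkedResolution M₀ ρ M'' := by
  classical
  induction hT with
  | intro T _ ih =>
  intro X' σ M' hσ pts st hclosed hdata cms cst ctr wreg hTeq hcdata hdisj₁ hdisjW hdisjWW hdisj₂ hdisj₃ hcover
  haveI : IsLocallyNoetherian X' := hσ.isLocallyNoetherian
  haveI : JacobsonSpace X' := jacobsonSpace_of_isMultipleBlowup hσ
  have hmult' : M'.mult = p := hσ.mult_eq.trans hmult
  rcases cms.eq_empty_or_nonempty with hcms | ⟨c₁, hc₁⟩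
  · -- no coordinate member: the point forest
    haveI : Std.Irrefl (fun s' s : State K => Edge p Finset.univ s s' ∧ s' ≠ s) := ⟨fun s hs => hs.2 rfl⟩
    have hTp : Acc (Relation.CutExpand (fun s' s : State K => Edge p Finset.univ s s' ∧ s' ≠ s))
        (pts.val.map st) := by
      refine Relation.acc_of_singleton fun s hs => ?_
      rw [Multiset.mem_map] at hs
      obtain ⟨x, hx, rfl⟩ := hs
      exact (Subrelation.accessible (fun hs => hs.1) (hdata x (Finset.mem_val.mp hx)).2.2.2.1).cutExpand
    refine exists_isMarkedResolution_of_config_local M₀ hE hmult _ hTp X' σ M' hσ pts st rfl hclosed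
      (fun z hz hzo => ?_) hdata
    rcases hcover z hz hzo with h | ⟨c, hc, -⟩ | ⟨c, hc, -⟩
    · exact h
    all_goals rw [hcms] at hc; exact absurd hc (Finset.notMem_empty c)
  -- blow up the coordinate member `c₁`
  obtain ⟨hF₁, hclean₁, hS₁, hreg₁, hsnc₁, ⟨Y, φ, ψ, _, _, hM₁, hZ₁, hcφ₁, -⟩, hblocks₁, hacc₁, -⟩ := hcdata c₁ hc₁
  have hP3 := (hblocks₁ _ Relation.ReflTransGen.refl).2.2.1
  set s₁ := cst c₁ with hs₁
  set S₁ := ctr c₁ with hS₁def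
  set Ce : X'.IdealSheafData := vanishingIdeal c₁ with hCe
  have hπ : IsBlowup (blowup.π Ce) Ce := blowup.isBlowup Ce
  have hCsupp : ∀ z : X', z ∉ (Ce.support : Set X') ↔ z ∉ (c₁ : Set X') := fun z => by
    rw [hCe, Scheme.IdealSheafData.coe_support_vanishingIdeal]
  have h₁ : IsMultipleBlowup M₀ (blowup.π Ce ≫ σ) (M'.transform (blowup.π Ce) Ce) :=
    IsMultipleBlowup.blowup hσ Ce (blowup.π Ce) hπ hreg₁
      (by rw [hCe, Scheme.IdealSheafData.coe_support_vanishingIdeal]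
          exact coe_member_subset_support φ ψ M' hmult' _ hM₁ hS₁.2 c₁ hZ₁ hcφ₁) hsnc₁
  haveI : IsLocallyNoetherian (blowup Ce) := h₁.isLocallyNoetherian
  set M'' := M'.transform (blowup.π Ce) Ce with hM''
  have hM''I : M''.ideal = controlledTransform (blowup.π Ce) Ce M'.ideal M'.mult := rfl
  -- the members side of the step
  obtain ⟨cms', cst', ctr', wreg', hcdata', hdisj₁', hdisjW', hdisjWW', hTid, hpairs, hsit, hrsit, hcov, hwcov, hscov, hfin⟩ :=
    joint_hereditary_node_step M' hmult' plan leaves wplan cms cst ctr wreg hcdata hdisj₁ hdisjW hdisjWW hc₁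
  -- leaf points: closed order-`p` points over `c₁` outside all new members and regions
  set ov : Finset (blowup Ce) := hfin.toFinset with hov_def
  have hmem_over : ∀ w, w ∈ ov ↔ IsClosed ({w} : Set (blowup Ce)) ∧ blowup.π Ce w ∈ (c₁ : Set X') ∧
      (p : ℕ∞) ≤ idealOrder M''.ideal w ∧ (∀ d ∈ cms', w ∉ (d : Set (blowup Ce))) ∧
      ∀ d ∈ cms', ∀ wt ∈ wplan (cst' d) (ctr' d), w ∉ (wreg' d wt : Set (blowup Ce)) := fun w => by
    rw [hov_def, Set.Finite.mem_toFinset, Set.mem_setOf_eq]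
  have hleaf : ∀ w : blowup Ce, IsClosed ({w} : Set (blowup Ce)) → blowup.π Ce w ∈ (c₁ : Set X') →
      (p : ℕ∞) ≤ idealOrder M''.ideal w → (∀ d ∈ cms', w ∉ (d : Set (blowup Ce))) →
      (∀ d ∈ cms', ∀ wt ∈ wplan (cst' d) (ctr' d), w ∉ (wreg' d wt : Set (blowup Ce))) →
      ∃ l ∈ leaves s₁ S₁, l.1 ∈ S₁ ∧ l.2 l.1 = 0 ∧ CentreBlowup.IsEquimultiplePoint p S₁ l.1 l.2 s₁ ∧
        ∃ (Y' : Scheme.{0}) (φ' : Y' ⟶ blowup Ce) (ψ' : Y' ⟶ P 4 K) (_ : IsOpenImmersion φ') (_ : IsOpenImmersion ψ')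
          (y' : Y'), φ' y' = w ∧ ψ' y' = ξ 4 K ∧
          M''.ideal.comap φ' = (hypSheaf p (CentreBlowup.step p S₁ l.1 l.2 s₁).F).comap ψ' := fun w hw hwc hord hout houtr => by
    rcases hcov w hw hwc hord with ⟨d, hd, hwd⟩ | ⟨d, hd, wt, hwt, hwd⟩ | h
    · exact absurd hwd (hout d hd)
    · exact absurd hwd (houtr d hd wt hwt)
    · exact h
  -- point survivors
  have hpre : ∀ z : {z // z ∈ pts}, ∃ w : blowup Ce, blowup.π Ce w = z.1 := fun z =>
    exists_eq_of_not_mem_support hπ ((hCsupp z.1).mpr (hdisj₂ z.1 z.2 c₁ hc₁))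
  set pre : {z // z ∈ pts} → blowup Ce := fun z => (hpre z).choose with hpre_def
  have hπpre : ∀ z : {z // z ∈ pts}, blowup.π Ce (pre z) = z.1 := fun z => (hpre z).choose_spec
  set surv : Finset (blowup Ce) := pts.attach.image pre with hsurv_def
  have hmem_surv : ∀ w, w ∈ surv ↔ blowup.π Ce w ∈ pts := by
    intro w
    rw [hsurv_def, Finset.mem_image]
    refine ⟨by rintro ⟨z, -, rfl⟩; rw [hπpre z]; exact z.2, fun hw => ⟨⟨blowup.π Ce w, hw⟩, Finset.mem_attach _ _,
      eq_of_eq_of_not_mem_support hπ (hπpre _) (by rw [hπpre]; exact (hCsupp _).mpr (hdisj₂ _ hw c₁ hc₁))⟩⟩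
  have hdisj_os : Disjoint ov surv := Finset.disjoint_left.mpr fun ⦃w⦄ hw hw' =>
    hdisj₂ _ ((hmem_surv w).mp hw') c₁ hc₁ ((hmem_over w).mp hw).2.1
  set pts' : Finset (blowup Ce) := ov.disjUnion surv hdisj_os with hpts'
  have hmem' : ∀ w, w ∈ pts' ↔ w ∈ ov ∨ w ∈ surv := fun w => Finset.mem_disjUnion
  have hsurv_ord : ∀ w : blowup Ce, blowup.π Ce w ∉ (c₁ : Set X') →
      idealOrder M''.ideal w = idealOrder M'.ideal (blowup.π Ce w) := fun w hwx =>
    idealOrder_controlledTransform_eq_of_eq_of_not_mem_support hπ ((hCsupp _).mpr hwx) M'.ideal M'.mult rfl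
  set st' : blowup Ce → State K := fun w =>
    if hc : IsClosed ({w} : Set (blowup Ce)) ∧ blowup.π Ce w ∈ (c₁ : Set X') ∧
        (p : ℕ∞) ≤ idealOrder M''.ideal w ∧ (∀ d ∈ cms', w ∉ (d : Set (blowup Ce))) ∧
        ∀ d ∈ cms', ∀ wt ∈ wplan (cst' d) (ctr' d), w ∉ (wreg' d wt : Set (blowup Ce)) then
      CentreBlowup.step p S₁ (hleaf w hc.1 hc.2.1 hc.2.2.1 hc.2.2.2.1 hc.2.2.2.2).choose.1
        (hleaf w hc.1 hc.2.1 hc.2.2.1 hc.2.2.2.1 hc.2.2.2.2).choose.2 s₁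
    else st (blowup.π Ce w) with hst'
  have hover : ∀ w ∈ ov, ∃ l ∈ leaves s₁ S₁, st' w = CentreBlowup.step p S₁ l.1 l.2 s₁ ∧ l.1 ∈ S₁ ∧ l.2 l.1 = 0 ∧
      CentreBlowup.IsEquimultiplePoint p S₁ l.1 l.2 s₁ ∧
      ∃ (Y' : Scheme.{0}) (φ' : Y' ⟶ blowup Ce) (ψ' : Y' ⟶ P 4 K) (_ : IsOpenImmersion φ') (_ : IsOpenImmersion ψ')
        (y' : Y'), φ' y' = w ∧ ψ' y' = ξ 4 K ∧
        M''.ideal.comap φ' = (hypSheaf p (CentreBlowup.step p S₁ l.1 l.2 s₁).F).comap ψ' := by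
    intro w hw
    have hc := (hmem_over w).mp hw
    obtain ⟨hl, hrest⟩ := (hleaf w hc.1 hc.2.1 hc.2.2.1 hc.2.2.2.1 hc.2.2.2.2).choose_spec
    exact ⟨_, hl, by rw [hst']; exact dif_pos hc, hrest⟩
  have hoff : ∀ w : blowup Ce, blowup.π Ce w ∉ (c₁ : Set X') → st' w = st (blowup.π Ce w) := fun w hwx => by
    rw [hst']; exact dif_neg fun hc => hwx hc.2.1
  -- the multiset of the members' pairs decreases
  have hcut : Relation.CutExpand (fun q' q : State K × Finset (Fin 4) => HEdge p plan wplan q' q ∧ q' ≠ q)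
      (∑ d ∈ cms', ({(cst' d, ctr' d)} : Multiset (State K × Finset (Fin 4)))) T := by
    refine ⟨((plan s₁ S₁).val.map fun e => (CentreBlowup.step p S₁ e.1 e.2.1 s₁, e.2.2)) +
        ((wplan s₁ S₁).val.map fun wt => (CentreBlowup.step p S₁ wt.1 wt.2.1 s₁, wt.2.2)), (s₁, S₁), fun a ha => ?_, ?_⟩
    · have hrel : HEdge p plan wplan a (s₁, S₁) := by
        rcases Multiset.mem_add.mp ha with ha | ha
        · rw [Multiset.mem_map] at ha
          obtain ⟨e, he, rfl⟩ := ha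
          exact Or.inl ⟨e, Finset.mem_val.mp he, rfl⟩
        · rw [Multiset.mem_map] at ha
          obtain ⟨wt, hwt, rfl⟩ := ha
          exact Or.inr ⟨wt, Finset.mem_val.mp hwt, rfl⟩
      exact ⟨hrel, fun heq => not_rel_self_of_acc hacc₁ (heq ▸ hrel)⟩
    · rw [← hTeq, ← add_assoc]
      exact hTid
  -- recurse on the new stage
  refine ih _ hcut (blowup Ce) (blowup.π Ce ≫ σ) M'' h₁ pts' st' (fun w hw => ?_) (fun w hw => ?_) cms' cst' ctr' wreg'
    rfl hcdata' hdisj₁' hdisjW' hdisjWW' (fun w hw d hd => ?_) (fun w hw d hd wt hwt => ?_) (fun z hz hzo => ?_)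
  · -- closedness of the point members
    rcases (hmem' w).mp hw with hw | hw
    · exact ((hmem_over w).mp hw).1
    · have hz := (hmem_surv w).mp hw
      exact isClosed_singleton_of_not_mem_support hπ (hclosed _ hz) ((hCsupp _).mpr (hdisj₂ _ hz c₁ hc₁))
  · -- data of the point members
    rcases (hmem' w).mp hw with hw | hw
    · obtain ⟨l, hl, hst'w, hl1, hl2, heq, Y', φ', ψ', _, _, y', hφ', hψ', hMw⟩ := hover w hw
      obtain ⟨haccl, hfinl⟩ := hP3 l hl heq
      rw [hst'w]
      refine ⟨step_F_ne_zero_of_isClean hl1 l.2 s₁ hF₁ hclean₁ hS₁.2, isClean_step S₁ l.1 l.2 s₁,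
        ordAlong_univ_step_of_isEquimultiplePoint' S₁ l.1 l.2 s₁ heq, haccl, fun s' hs' => ?_, Y', φ', ψ',
        inferInstance, inferInstance, y', hφ', hψ', hMw⟩
      exact finite_closedOver_model_of_finite_pairs s'
        (ordAlong_univ_of_reflTransGen_edge (ordAlong_univ_step_of_isEquimultiplePoint' S₁ l.1 l.2 s₁ heq) hs')
        (hfinl s' hs')
    · have hz := (hmem_surv w).mp hw
      obtain ⟨hFz, hcleanz, hpermz, haccz, hlocfinz, Yz, φz, ψz, _, _, yz, hφz, hψz, hMz⟩ := hdata _ hz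
      have hnot : blowup.π Ce w ∉ (Ce.support : Set X') := (hCsupp _).mpr (hdisj₂ _ hz c₁ hc₁)
      obtain ⟨Y', φ', ψ', _, _, y', hφ', hψ', hMw⟩ :=
        exists_zigzag_comap_controlledTransform_of_not_mem_support hπ hnot φz ψz yz hφz hψz M'.ideal
          (hypSheaf p (st (blowup.π Ce w)).F) hMz M'.mult (w := w) rfl
      rw [hoff w (hdisj₂ _ hz c₁ hc₁)]
      exact ⟨hFz, hcleanz, hpermz, haccz, hlocfinz, Y', φ', ψ', inferInstance, inferInstance, y', hφ', hψ',
        by rw [hM''I]; exact hMw⟩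
  · -- point members avoid coordinate members
    rcases (hmem' w).mp hw with hw | hw
    · exact ((hmem_over w).mp hw).2.2.2.1 d hd
    · intro hwd
      have hz := (hmem_surv w).mp hw
      rcases hsit d hd w hwd with h | ⟨wt, hwt, h⟩ | ⟨c, hc, -, h⟩
      · exact hdisj₂ _ hz c₁ hc₁ h
      · exact hdisj₃ _ hz c₁ hc₁ wt hwt h
      · exact hdisj₂ _ hz c hc h
  · -- point members avoid the regions
    intro hwd
    rcases (hmem' w).mp hw with hw | hw
    · exact ((hmem_over w).mp hw).2.2.2.2 d hd wt hwt hwd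
    · have hz := (hmem_surv w).mp hw
      rcases hrsit d hd wt hwt w hwd with h | ⟨c, hc, -, wt₀, hwt₀, h⟩
      · exact hdisj₂ _ hz c₁ hc₁ h
      · exact hdisj₃ _ hz c hc wt₀ hwt₀ h
  · -- every closed order-`p` point of the new stage is a point member, on a member, or in a region
    by_cases hzx : blowup.π Ce z ∈ (c₁ : Set X')
    · by_cases hk : ∃ d ∈ cms', z ∈ (d : Set (blowup Ce))
      · exact Or.inr (Or.inl hk)
      · by_cases hr : ∃ d ∈ cms', ∃ wt ∈ wplan (cst' d) (ctr' d), z ∈ (wreg' d wt : Set (blowup Ce))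
        · exact Or.inr (Or.inr hr)
        · push Not at hk hr
          exact Or.inl ((hmem' z).mpr (Or.inl ((hmem_over z).mpr ⟨hz, hzx, hzo, hk, hr⟩)))
    · have hzo' : (p : ℕ∞) ≤ idealOrder M'.ideal (blowup.π Ce z) := by rw [← hsurv_ord z hzx]; exact hzo
      rcases hcover _ (isClosed_singleton_π' hπ hz) hzo' with h | ⟨c, hc, hzc⟩ | ⟨c, hc, wt, hwt, hzc⟩
      · exact Or.inl ((hmem' z).mpr (Or.inr ((hmem_surv z).mpr h)))
      · have hcc : c ≠ c₁ := fun h => hzx (by rw [← h]; exact hzc)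
        exact Or.inr (Or.inl ((hscov z c hc hcc).1 hzc))
      · by_cases hcc : c = c₁
        · subst hcc
          exact Or.inr (Or.inl (hwcov z hz hzo hzx wt hwt hzc))
        · exact Or.inr (Or.inr ((hscov z c hc hcc).2 wt hwt hzc))

/-- **COROLLARY: a node that is its own root.** The node theorem started at `σ = 𝟙`: the `CutExpand` accessibility of the initial multiset
of pairs comes from the members' `Acc` data. [cite: BierstoneGrigorievMilmanWlodarczyk2011, Def. 3.1.3] -/
theorem exists_isMarkedResolution_of_hereditary_node {X₀ : Scheme.{0}} [IsLocallyNoetherian X₀] [JacobsonSpace X₀]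
    [IsAlgClosed K] [DecidableEq K] (M₀ : MarkedIdeal X₀) (hE : HasSNC M₀.boundary) (hmult : M₀.mult = p)
    (plan : State K → Finset (Fin 4) → Finset (Fin 4 × (Fin 4 → K) × Finset (Fin 4)))
    (leaves : State K → Finset (Fin 4) → Finset (Fin 4 × (Fin 4 → K)))
    (wplan : State K → Finset (Fin 4) → Finset (Fin 4 × (Fin 4 → K) × Finset (Fin 4)))
    (pts : Finset X₀) (st : X₀ → State K) (hclosed : ∀ x ∈ pts, IsClosed ({x} : Set X₀))
    (hdata : ∀ x ∈ pts, PointData p M₀ x (st x))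
    (cms : Finset (Closeds X₀)) (cst : Closeds X₀ → State K) (ctr : Closeds X₀ → Finset (Fin 4))
    (wreg : Closeds X₀ → Fin 4 × (Fin 4 → K) × Finset (Fin 4) → Closeds X₀)
    (hcdata : ∀ c ∈ cms, MemberDataH p plan leaves wplan M₀ c (cst c) (ctr c) (wreg c))
    (hdisj₁ : ∀ c ∈ cms, ∀ c' ∈ cms, c ≠ c' → Disjoint (c : Set X₀) (c' : Set X₀))
    (hdisjW : ∀ c ∈ cms, ∀ c' ∈ cms, c ≠ c' → ∀ wt ∈ wplan (cst c') (ctr c'), Disjoint (c : Set X₀) (wreg c' wt : Set X₀))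
    (hdisjWW : ∀ c ∈ cms, ∀ c' ∈ cms, c ≠ c' → ∀ wt ∈ wplan (cst c) (ctr c), ∀ wt' ∈ wplan (cst c') (ctr c'),
      Disjoint (wreg c wt : Set X₀) (wreg c' wt' : Set X₀))
    (hdisj₂ : ∀ x ∈ pts, ∀ c ∈ cms, x ∉ (c : Set X₀))
    (hdisj₃ : ∀ x ∈ pts, ∀ c ∈ cms, ∀ wt ∈ wplan (cst c) (ctr c), x ∉ (wreg c wt : Set X₀))
    (hcover : ∀ z : X₀, IsClosed ({z} : Set X₀) → (p : ℕ∞) ≤ idealOrder M₀.ideal z →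
      z ∈ pts ∨ (∃ c ∈ cms, z ∈ (c : Set X₀)) ∨ ∃ c ∈ cms, ∃ wt ∈ wplan (cst c) (ctr c), z ∈ (wreg c wt : Set X₀)) :
    ∃ (X'' : Scheme.{0}) (ρ : X'' ⟶ X₀) (M'' : MarkedIdeal X''), IsMarkedResolution M₀ ρ M'' := by
  classical
  haveI : Std.Irrefl (fun q' q : State K × Finset (Fin 4) => HEdge p plan wplan q' q ∧ q' ≠ q) := ⟨fun q hq => hq.2 rfl⟩
  have hT : Acc (Relation.CutExpand (fun q' q : State K × Finset (Fin 4) => HEdge p plan wplan q' q ∧ q' ≠ q))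
      (∑ c ∈ cms, ({(cst c, ctr c)} : Multiset (State K × Finset (Fin 4)))) := by
    refine Relation.acc_of_singleton fun q hq => ?_
    obtain ⟨c, hc, hq⟩ := Multiset.mem_sum.mp hq
    rw [Multiset.mem_singleton] at hq
    subst hq
    exact (Subrelation.accessible (fun h => h.1) (hcdata c hc).2.2.2.2.2.2.2.1).cutExpand
  exact exists_isMarkedResolution_of_joint_forest_hereditary M₀ hE hmult plan leaves wplan _ hT X₀ (𝟙 X₀) M₀
    (IsMultipleBlowup.refl M₀) pts st hclosed hdata cms cst ctr wreg rfl hcdata hdisj₁ hdisjW hdisjWW hdisj₂ hdisj₃ hcover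

end NodesH

end Equimultiple

end Summit.ResolutionOfSingularities.ResolutionOfSingularities.Theorems.PIDim4

end
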